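import Summits.Schanuel.Schanuel.Theorems.RootDecomp1KDarkLogSq03

/-!
# RootDecomp1KDarkLogSq — lens 6, generation 19 «DARK LOG-SQUARE KERNEL ⇒ THE POSITIVE-ORDER LAYER F₊ OF 33364 IS CLOSED AT n = 2» (K-R27 (F₊) lane; input NW96 Thm 1 BY NAME) — continuation (RootDecomp1KDarkLogSq04): §4 the positive-order layer F₊ at level 2 (`posLayer_two_of_NW`, `item33364_two_logHyperClass`, reductions) + §5 the residual-shrink certificate `sb_two_of_logFloorResidual`

(lens-6 g19 `DarkLogSq.lean` [HOME/decomp-schanuel-lens-6/g19/ sha256 81ff816b…, 1170 l; NODE L1934 / REQUEST L1935; critic VERDICT L1938 (K-R27 (F₊) cell credit, port GO)]; port by census-1 gen 17 as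
`RootDecomp1KDarkLogSq01`–`06` — see the PORT NOTE of part 01; `--supports stmt-Schanuel-33364`; rung 0.)
-/

noncomputable section

open Complex IntermediateField Filter Polynomial
open Literature.NumberTheory.Transcendental (NesterenkoWaldschmidt1996_thm_1)
open Summit.Schanuel.Schanuel.Theorems.RootDecomp1KHyper
open Summit.Schanuel.Schanuel.Theorems.RootDecomp1KHyper.HyperCell
open Summit.Schanuel.Schanuel.Theorems.RootDecomp1KGeneric (LiouvilleOrder LogSqLiouville sb_two_of_ordRatio
  sb_two_of_lowOrderResidual)
open Summit.Schanuel.Schanuel.Theorems.RootDecomp1KRelLiouvilleCell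

namespace Summit.Schanuel.Schanuel.Theorems.RootDecomp1KDarkLogSq

/-! ## §4. The positive-order layer F₊ at level 2

Two routes into `LogHyperLiouville`: (a) exponential order `≥ 1` (`LiouvilleOrder 1`: `exp(−q)` beats every
`exp(−(log q)^m)`); (b) the layer binder itself: a ℚ-free pair VIOLATING Diaz's (T.H.) has a log-hyper-Liouville
ratio (`exp(−H^ε)` beats every `exp(−(log H)^m)`).  Hence `PosLayer` (TREE `RootDecomp1KTHLayer.PosLayer`) restricted
to `n = 2` is a theorem mod NW96 Thm 1. -/

/-- `(log q)^m ≤ q` beyond a threshold. -/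
theorem exists_pow_log_le (m : ℕ) : ∃ N : ℕ, ∀ q : ℕ, N ≤ q → Real.log (q : ℝ) ^ m ≤ (q : ℝ) := by
  have hev : ∀ᶠ x : ℝ in atTop, ‖Real.log x ^ (m : ℝ)‖ ≤ 1 * ‖x ^ (1 : ℝ)‖ :=
    (isLittleO_log_rpow_rpow_atTop (m : ℝ) one_pos).bound one_pos
  obtain ⟨x₀, hx₀⟩ := eventually_atTop.mp hev
  refine ⟨max 1 ⌈x₀⌉₊, fun q hq => ?_⟩
  have hq1 : (1 : ℝ) ≤ q := by exact_mod_cast (le_max_left _ _).trans hq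
  have hqx : x₀ ≤ (q : ℝ) := (Nat.le_ceil x₀).trans (by exact_mod_cast (le_max_right _ _).trans hq)
  have h := hx₀ (q : ℝ) hqx
  rw [Real.rpow_natCast, Real.rpow_one, one_mul, Real.norm_eq_abs, Real.norm_eq_abs,
    abs_of_nonneg (pow_nonneg (Real.log_nonneg hq1) _), abs_of_nonneg (by positivity)] at h
  exact h

/-- **(a)** Exponential order `1` implies log-hyper-Liouville. -/
theorem logHyperLiouville_of_liouvilleOrder_one {ρ : ℝ} (hρ : LiouvilleOrder 1 ρ) :
    LogHyperLiouville ρ := by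
  intro m
  obtain ⟨N, hN⟩ := exists_pow_log_le m
  obtain ⟨r, hden, hne, hlt⟩ := hρ (max m N)
  refine ⟨r, (le_max_left _ _).trans hden, hne, hlt.trans_le ?_⟩
  rw [Real.exp_le_exp, neg_le_neg_iff, pow_one]
  exact hN r.den ((le_max_right _ _).trans hden)

/-- Hence every positive exponential order. -/
theorem logHyperLiouville_of_liouvilleOrder {ρ : ℝ} {k : ℕ} (hk : 1 ≤ k) (hρ : LiouvilleOrder k ρ) :
    LogHyperLiouville ρ :=
  logHyperLiouville_of_liouvilleOrder_one (hρ.mono hk)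

/-- **Level 2 on the whole positive-order layer (mod NW96 Thm 1)**: every ℚ-free pair with a real ratio of SOME
positive exponential Liouville order has Schanuel's bound — the tree had this for order `≥ 49`
(`RootDecomp1KGeneric.sb_two_of_ordRatio`). -/
theorem sb_two_of_posOrderRatio (hNW : NesterenkoWaldschmidt1996_thm_1) {z : Fin 2 → ℂ}
    (hz : LinearIndependent ℚ z) {ρ : ℝ} {k : ℕ} (hk : 1 ≤ k) (hρ : LiouvilleOrder k ρ)
    (h1 : z 1 = (ρ : ℂ) * z 0) : SB 2 z :=
  sb_two_of_logHyperRatio hNW hz (logHyperLiouville_of_liouvilleOrder hk hρ) h1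

open Literature.Barriers.Schanuel (TechnicalHypothesis) in
/-- **(b)** A ℚ-free `LinLiouville` pair VIOLATING (T.H.) has a LOG-HYPER-Liouville real ratio: the violating forms
`|h₀ z₀ + h₁ z₁| < exp(−H^ε)`, `|hᵢ| ≤ H`, give rationals `−h₀/h₁` with `|ρ + h₀/h₁| < exp(−H^ε)/‖z₀‖ ≤ exp(−(log den)^M)`
for large `H` (`(log H)^M = o(H^ε)`), and irrationality of `ρ` forces `den → ∞`. -/
theorem exists_logHyperLiouville_ratio_of_not_technicalHypothesis {z : Fin 2 → ℂ}
    (hz : LinearIndependent ℚ z) (hL : LinLiouville z) (hnTH : ¬ TechnicalHypothesis z) :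
    ∃ ρ : ℝ, LogHyperLiouville ρ ∧ z 1 = (ρ : ℂ) * z 0 := by
  have h0 : z 0 ≠ 0 := hz.ne_zero 0
  have hn0 : 0 < ‖z 0‖ := norm_pos_iff.mpr h0
  obtain ⟨ρ, hρL, hz1⟩ := exists_liouville_ratio_of_linLiouville hz hL
  have hρirr : Irrational ρ := hρL.irrational
  have hform : ∀ h : Fin 2 → ℤ,
      ‖∑ i, (h i : ℂ) * z i‖ = ‖z 0‖ * |(h 0 : ℝ) + (h 1 : ℝ) * ρ| := by
    intro h
    have e : ∑ i, (h i : ℂ) * z i = z 0 * (((h 0 : ℝ) + (h 1 : ℝ) * ρ : ℝ) : ℂ) := by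
      rw [form_two, hz1]; push_cast; ring
    rw [e, norm_mul, Complex.norm_real, Real.norm_eq_abs]
  -- unpack ¬(T.H.)
  unfold TechnicalHypothesis at hnTH
  push Not at hnTH
  obtain ⟨ε, hε, hbad⟩ := hnTH
  -- it suffices to treat `M ≥ 3` (then `log den ≥ 1` and the exponents are monotone in `M`)
  suffices aux : ∀ M : ℕ, 3 ≤ M →
      ∃ r : ℚ, M ≤ r.den ∧ ρ ≠ r ∧ |ρ - r| < Real.exp (-(Real.log r.den) ^ M) by
    refine ⟨ρ, fun m => ?_, hz1⟩
    obtain ⟨r, hden, hne, hlt⟩ := aux (max m 3) (le_max_right _ _)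
    refine ⟨r, (le_max_left _ _).trans hden, hne, hlt.trans_le ?_⟩
    rw [Real.exp_le_exp, neg_le_neg_iff]
    have h3 : (3 : ℝ) ≤ r.den := by exact_mod_cast (le_max_right m 3).trans hden
    have hlog1 : 1 ≤ Real.log (r.den : ℝ) := by
      rw [Real.le_log_iff_exp_le (by positivity)]
      exact (Real.exp_one_lt_d9.le.trans (by norm_num)).trans h3
    exact pow_le_pow_right₀ hlog1 (le_max_left _ _)
  intro M hM
  -- distance from `ρ` to the rationals of denominator `≤ M`
  obtain ⟨δ₀, hδ₀, hfar⟩ : ∃ δ₀ : ℝ, 0 < δ₀ ∧ ∀ r : ℚ, r.den ≤ M → δ₀ ≤ |ρ - r| := by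
    have hev := hρirr.eventually_forall_le_dist_cast_rat_of_den_le M
    obtain ⟨δ, hδ, hδ0⟩ :=
      ((hev.filter_mono nhdsWithin_le_nhds).and (self_mem_nhdsWithin (s := Set.Ioi (0 : ℝ)))).exists
    exact ⟨δ, hδ0, fun r hr => by simpa [Real.dist_eq] using hδ r hr⟩
  -- growth: `(log x)^M ≤ x^ε / 2` beyond `H₁`
  have hev : ∀ᶠ x : ℝ in atTop, ‖Real.log x ^ (M : ℝ)‖ ≤ (1 / 2) * ‖x ^ ε‖ :=
    (isLittleO_log_rpow_rpow_atTop (M : ℝ) hε).bound (by norm_num)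
  obtain ⟨H₁, hH₁⟩ := eventually_atTop.mp hev
  set η₀ : ℝ := min 1 δ₀ with hη₀def
  have hη₀0 : 0 < η₀ := lt_min one_pos hδ₀
  have hη₀1 : η₀ ≤ 1 := min_le_left _ _
  have hη₀δ : η₀ ≤ δ₀ := min_le_right _ _
  set H₀ : ℝ := max H₁ (max 3 (2 / (‖z 0‖ * η₀))) with hH₀def
  have hH₀3 : (3 : ℝ) ≤ H₀ := (le_max_left _ _).trans (le_max_right _ _)
  obtain ⟨H, hH, h, hh, hle, hlt⟩ := hbad H₀ (by linarith only [hH₀3])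
  have hH3 : 3 ≤ H := hH₀3.trans hH
  have hH0 : 0 < H := by linarith only [hH3]
  have hHinv : 2 / (‖z 0‖ * η₀) ≤ H := ((le_max_right _ _).trans (le_max_right _ _)).trans hH
  have hlogH1 : 1 ≤ Real.log H := by
    rw [Real.le_log_iff_exp_le hH0]
    exact (Real.exp_one_lt_d9.le.trans (by norm_num)).trans hH3
  have hlogH0 : 0 ≤ Real.log H := by linarith only [hlogH1]
  have hgrow : Real.log H ^ M ≤ H ^ ε / 2 := by
    have h1 := hH₁ H ((le_max_left _ _).trans hH)
    rw [Real.rpow_natCast, Real.norm_eq_abs, abs_of_nonneg (pow_nonneg hlogH0 _), Real.norm_eq_abs,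
      abs_of_nonneg (Real.rpow_nonneg hH0.le _)] at h1
    linarith only [h1]
  have hlogM : Real.log H ≤ Real.log H ^ M := le_self_pow₀ hlogH1 (by omega)
  -- the small form
  rw [hform h] at hlt
  set f : ℝ := (h 0 : ℝ) + (h 1 : ℝ) * ρ with hf
  set B : ℝ := Real.exp (-(Real.log H ^ M)) with hBdef
  have hB0 : 0 < B := Real.exp_pos _
  have hB1 : B ≤ 1 := by rw [hBdef, Real.exp_le_one_iff]; linarith only [pow_nonneg hlogH0 M]
  -- `exp(−H^ε) ≤ B / H`
  have hexp : Real.exp (-(H ^ ε)) ≤ B * H⁻¹ := by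
    have e1 : H⁻¹ = Real.exp (-Real.log H) := by rw [Real.exp_neg, Real.exp_log hH0]
    rw [e1, hBdef, ← Real.exp_add, Real.exp_le_exp]
    linarith only [hgrow, hlogM, Real.rpow_nonneg hH0.le ε]
  -- `|f| < B · η₀ / 2`
  have h2 : 2 ≤ η₀ * ‖z 0‖ * H := by
    have := (div_le_iff₀ (mul_pos hn0 hη₀0)).mp hHinv
    linarith only [this, show H * (‖z 0‖ * η₀) = η₀ * ‖z 0‖ * H by ring]
  have hf_lt : |f| < B * (η₀ / 2) := by
    have hlt' : ‖z 0‖ * |f| < B * H⁻¹ := hlt.trans_le hexp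
    -- multiply through by `H ‖z 0‖`
    have hHz : 0 < H * ‖z 0‖ := mul_pos hH0 hn0
    have e2 : B * H⁻¹ = B / H := by rw [div_eq_mul_inv]
    rw [e2, lt_div_iff₀ hH0] at hlt'
    -- hlt' : ‖z 0‖ * |f| * H < B
    have hBη : B * 2 ≤ B * (η₀ * ‖z 0‖ * H) := mul_le_mul_of_nonneg_left h2 hB0.le
    nlinarith [hlt', hBη, abs_nonneg f, hB0, hn0, hH0, hη₀0]
  have hf1 : |f| < 1 := by
    have : B * (η₀ / 2) ≤ 1 * (1 / 2) := mul_le_mul hB1 (by linarith only [hη₀1]) (by positivity) zero_le_one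
    linarith only [hf_lt, this]
  have hfδ : |f| < δ₀ := by
    have : B * (η₀ / 2) ≤ 1 * (δ₀ / 2) := mul_le_mul hB1 (by linarith only [hη₀δ]) (by positivity) zero_le_one
    linarith only [hf_lt, this, hδ₀]
  -- `h 1 ≠ 0`
  have h1 : h 1 ≠ 0 := by
    intro h10
    have h00 : h 0 ≠ 0 := by
      intro h00; apply hh; funext i; fin_cases i <;> simp [h00, h10]
    have hge : 1 ≤ |f| := by
      rw [hf]; simp only [h10, Int.cast_zero, zero_mul, add_zero]
      exact_mod_cast Int.one_le_abs h00
    linarith only [hge, hf1]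
  have h1R : (h 1 : ℝ) ≠ 0 := by exact_mod_cast h1
  have h1abs : (1 : ℝ) ≤ |(h 1 : ℝ)| := by exact_mod_cast Int.one_le_abs h1
  -- the rational `r = −h₀/h₁`
  set r : ℚ := Rat.divInt (-h 0) (h 1) with hr
  have hrR : (r : ℝ) = -(h 0 : ℝ) / (h 1 : ℝ) := by
    rw [hr, Rat.cast_divInt]; push_cast; ring
  have hdist : |ρ - r| = |f| / |(h 1 : ℝ)| := by
    rw [hrR, hf, ← abs_div]
    congr 1
    field_simp
    ring
  have hdist_le : |ρ - r| ≤ |f| := by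
    rw [hdist]; exact div_le_self (abs_nonneg _) h1abs
  have hden_le : (r.den : ℝ) ≤ |(h 1 : ℝ)| := by
    have hd : (r.den : ℤ) ∣ h 1 := by rw [hr]; exact Rat.den_dvd _ _
    have := Int.le_of_dvd (abs_pos.mpr h1) ((dvd_abs _ _).mpr hd)
    exact_mod_cast this
  have hdenH : (r.den : ℝ) ≤ H := hden_le.trans (hle 1)
  have hden1 : (1 : ℝ) ≤ r.den := by exact_mod_cast r.den_pos
  refine ⟨r, ?_, hρirr.ne_rat r, ?_⟩
  · -- `den r > M`, else `δ₀ ≤ |ρ − r|`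
    by_contra hltM
    have := hfar r (by omega)
    linarith only [this, hdist_le, hfδ]
  · -- `|ρ − r| ≤ |f| < B η₀/2 ≤ B/2 < exp(−(log den)^M)`
    have hBden : B ≤ Real.exp (-(Real.log r.den) ^ M) := by
      rw [hBdef, Real.exp_le_exp, neg_le_neg_iff]
      exact pow_le_pow_left₀ (Real.log_nonneg hden1) (Real.log_le_log (by positivity) hdenH) M
    have : B * (η₀ / 2) < B := by
      have : η₀ / 2 < 1 := by linarith only [hη₀1]
      calc B * (η₀ / 2) < B * 1 := mul_lt_mul_of_pos_left this hB0
        _ = B := mul_one B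
    linarith only [hdist_le, hf_lt, this, hBden]

open Literature.Barriers.Schanuel (TechnicalHypothesis) in
/-- **`PosLayer` AT LEVEL 2 IS A THEOREM mod NW96 Thm 1.**  Item 33364's binders VERBATIM at `n = 2` plus the layer
binder `¬ (T.H.)` (TREE `RootDecomp1KTHLayer.PosLayer` is exactly this for all `n`; TREE `item33364_iff_layers :
Item33364 ↔ PosLayer ∧ THLayer`).  So at `n = 2` the item REDUCES to its (T.H.) layer F₀. -/
theorem posLayer_two_of_NW (hNW : NesterenkoWaldschmidt1996_thm_1) (z : Fin 2 → ℂ)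
    (hz : LinearIndependent ℚ z)
    (hL : ∀ ω : ℕ, ∃ h : Fin 2 → ℤ, h ≠ 0 ∧ ‖∑ i, (h i : ℂ) * z i‖ < 1 / (1 + ∑ i, (|h i| : ℝ)) ^ ω)
    (_hH : ¬ ∀ m : ℕ, ∃ h : Fin 2 → ℤ, h ≠ 0 ∧
        ‖∑ i, (h i : ℂ) * z i‖ < Real.exp (-((1 + ∑ i, (|h i| : ℝ)) ^ m)))
    (hnTH : ¬ TechnicalHypothesis z) :
    ((2 : ℕ) : Cardinal) ≤ Algebra.trdeg ℚ
      ↥(IntermediateField.adjoin ℚ (Set.range z ∪ Set.range (Complex.exp ∘ z))) := by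
  obtain ⟨ρ, hρ, h1⟩ := exists_logHyperLiouville_ratio_of_not_technicalHypothesis hz hL hnTH
  exact sb_two_of_logHyperRatio hNW hz hρ h1

/-- **Item 33364's text at `n = 2`, restricted to the LOG-HYPER RATIO CLASS** (critic frame G19 (3)): the item's two
hypotheses VERBATIM at `n = 2` plus «the ratio `z₁/z₀` is a real log-hyper-Liouville number» give the item's conclusion,
mod NW96 Thm 1 — this is the part of level 2 that is DECIDED (it contains the whole layer F₊, `posLayer_two_of_NW`).
Read back against the LIVE decl in the probe file (P2′). -/
theorem item33364_two_logHyperClass (hNW : NesterenkoWaldschmidt1996_thm_1) (z : Fin 2 → ℂ)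
    (hz : LinearIndependent ℚ z)
    (_hL : ∀ ω : ℕ, ∃ h : Fin 2 → ℤ, h ≠ 0 ∧ ‖∑ i, (h i : ℂ) * z i‖ < 1 / (1 + ∑ i, (|h i| : ℝ)) ^ ω)
    (_hH : ¬ ∀ m : ℕ, ∃ h : Fin 2 → ℤ, h ≠ 0 ∧
        ‖∑ i, (h i : ℂ) * z i‖ < Real.exp (-((1 + ∑ i, (|h i| : ℝ)) ^ m)))
    (hcls : ∃ ρ : ℝ, LogHyperLiouville ρ ∧ z 1 = (ρ : ℂ) * z 0) :
    ((2 : ℕ) : Cardinal) ≤ Algebra.trdeg ℚ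
      ↥(IntermediateField.adjoin ℚ (Set.range z ∪ Set.range (Complex.exp ∘ z))) := by
  obtain ⟨ρ, hρ, h1⟩ := hcls
  exact sb_two_of_logHyperRatio hNW hz hρ h1

open Literature.Barriers.Schanuel (TechnicalHypothesis) in
/-- The same as an implication between the TREE's typed layers, restricted to `n = 2`:
`33364|₂ ⟸ F₀|₂` (the (T.H.) layer) mod NW96 Thm 1. -/
theorem item33364_two_of_thLayer_two (hNW : NesterenkoWaldschmidt1996_thm_1)
    (hF₀ : ∀ (z : Fin 2 → ℂ), LinearIndependent ℚ z →
      (∀ ω : ℕ, ∃ h : Fin 2 → ℤ, h ≠ 0 ∧ ‖∑ i, (h i : ℂ) * z i‖ < 1 / (1 + ∑ i, (|h i| : ℝ)) ^ ω) →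
      (¬ ∀ m : ℕ, ∃ h : Fin 2 → ℤ, h ≠ 0 ∧
          ‖∑ i, (h i : ℂ) * z i‖ < Real.exp (-((1 + ∑ i, (|h i| : ℝ)) ^ m))) →
      TechnicalHypothesis z →
      ((2 : ℕ) : Cardinal) ≤ Algebra.trdeg ℚ
        ↥(IntermediateField.adjoin ℚ (Set.range z ∪ Set.range (Complex.exp ∘ z))))
    (z : Fin 2 → ℂ) (hz : LinearIndependent ℚ z)
    (hL : ∀ ω : ℕ, ∃ h : Fin 2 → ℤ, h ≠ 0 ∧ ‖∑ i, (h i : ℂ) * z i‖ < 1 / (1 + ∑ i, (|h i| : ℝ)) ^ ω)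
    (hH : ¬ ∀ m : ℕ, ∃ h : Fin 2 → ℤ, h ≠ 0 ∧
        ‖∑ i, (h i : ℂ) * z i‖ < Real.exp (-((1 + ∑ i, (|h i| : ℝ)) ^ m))) :
    ((2 : ℕ) : Cardinal) ≤ Algebra.trdeg ℚ
      ↥(IntermediateField.adjoin ℚ (Set.range z ∪ Set.range (Complex.exp ∘ z))) := by
  by_cases hTH : TechnicalHypothesis z
  · exact hF₀ z hz hL hH hTH
  · exact posLayer_two_of_NW hNW z hz hL hH hTH

open Literature.Barriers.Schanuel (TechnicalHypothesis) in
/-- **`33364|₂ ⟸ 3816|₂` (mod NW96 Thm 1).**  At `n = 2` the finite-order item follows from the pair instance of Schanuel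
UNDER (T.H.) — the `n = 2` slice of the TREE text `RootDecomp1KTHLayer.UnderTH` (= live stmt-Schanuel-3816
`Theses.DiophantineCore.SchanuelUnderTH`, Waldschmidt's Conjecture 2.3): the Liouville binders of 33364 add nothing at `n = 2`
beyond (T.H.).  A REDUCTION (3816 is OPEN), recorded for the map; the decided part is `posLayer_two_of_NW`. -/
theorem item33364_two_of_underTH_two (hNW : NesterenkoWaldschmidt1996_thm_1)
    (hU₂ : ∀ (z : Fin 2 → ℂ), LinearIndependent ℚ z → TechnicalHypothesis z →
      ((2 : ℕ) : Cardinal) ≤ Algebra.trdeg ℚ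
        ↥(IntermediateField.adjoin ℚ (Set.range z ∪ Set.range (Complex.exp ∘ z))))
    (z : Fin 2 → ℂ) (hz : LinearIndependent ℚ z)
    (hL : ∀ ω : ℕ, ∃ h : Fin 2 → ℤ, h ≠ 0 ∧ ‖∑ i, (h i : ℂ) * z i‖ < 1 / (1 + ∑ i, (|h i| : ℝ)) ^ ω)
    (hH : ¬ ∀ m : ℕ, ∃ h : Fin 2 → ℤ, h ≠ 0 ∧
        ‖∑ i, (h i : ℂ) * z i‖ < Real.exp (-((1 + ∑ i, (|h i| : ℝ)) ^ m))) :
    ((2 : ℕ) : Cardinal) ≤ Algebra.trdeg ℚ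
      ↥(IntermediateField.adjoin ℚ (Set.range z ∪ Set.range (Complex.exp ∘ z))) :=
  item33364_two_of_thLayer_two hNW (fun z hz _ _ hT => hU₂ z hz hT) z hz hL hH

/-! ## §5. The residual of record at `n = 2` shrinks to the log-power floor -/

/-- **RESIDUAL SHRINK (mod NW96 Thm 1).**  Schanuel's bound at every ℚ-free `LinLiouville` pair follows from the pairs
`(t, ρt)`, `t ≠ 0`, whose real Liouville ratio is NOT log-hyper-Liouville.  (The tree's residual of record,
`RootDecomp1KGeneric.sb_two_of_lowOrderResidual`, excepted the ratios of NO exponential order `49`.) -/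
theorem sb_two_of_logFloorResidual (hNW : NesterenkoWaldschmidt1996_thm_1)
    (hres : ∀ (t : ℂ) (ρ : ℝ), t ≠ 0 → Liouville ρ → ¬ LogHyperLiouville ρ → SB 2 ![t, (ρ : ℂ) * t])
    (z : Fin 2 → ℂ) (hz : LinearIndependent ℚ z) (hL : LinLiouville z) : SB 2 z := by
  obtain ⟨ρ, hρ, h1⟩ := exists_liouville_ratio_of_linLiouville hz hL
  by_cases hlog : LogHyperLiouville ρ
  · exact sb_two_of_logHyperRatio hNW hz hlog h1
  · have ez : z = ![z 0, (ρ : ℂ) * z 0] := by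
      funext i; fin_cases i
      · rfl
      · simpa using h1
    rw [ez]
    exact hres (z 0) ρ (hz.ne_zero 0) hρ hlog

/-- The two residuals compared: the new exceptional class is contained in the old one (a ratio without log-hyper
approximations has no exponential order `1`, let alone `49`). -/
theorem logFloorResidual_sub_lowOrderResidual {ρ : ℝ} (h : ¬ LogHyperLiouville ρ) : ¬ LiouvilleOrder 49 ρ :=
  fun h49 => h (logHyperLiouville_of_liouvilleOrder (by norm_num) h49)

end Summit.Schanuel.Schanuel.Theorems.RootDecomp1KDarkLogSq

end
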